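import Summits.HodgeConjecture.HodgeConjecture.Theorems.F0P3cStCharTSUpTrSlotIntegrable   -- ★-to-be FILE 1 (this seat): (ii) `integrableOn_mul_orbitSum_cartanSet_of_le`, (iii) `integrableOn_weighted_mul_classOrbitalIntegral_of_le`
import Summits.HodgeConjecture.HodgeConjecture.Theorems.F0P3cStCharTSUpTrExchange         -- ★ (A1′)-D p852501 (LH10-p01 g8): `integrableOn_and_setIntegral_comp_embedding` (transport along `e : T_H ≃ₜ* T′`)
import HarnessLib

/-!
# F0 · P3c · ROAD «UP-TR» brick (A0 v2), FILE 2 «SLOT INTEGRABILITY IN THE ASSEMBLY'S `H`-TORUS LETTERS»: the binders `hIntG` ∕ `hIntT` of ★ (A1′)-E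
# `upTransferLB_concrete_of_inputs`, for a torus weight on `T_H` dominated by `D_G⁻¹` along the embedding `e : T_H ≃ₜ* Z_G(γ)` (Rogawski 1990 §12.5 pp. 182–183)

Cell `pub/hodgecm-mathlib`, crux H413 = `stmt-HodgeConjecture-24833` (lane `--supports … --as helper`); seat F0P2-p01 (g24); ROAD «UP-TR» (holder F0P3-p02 (g23)); consumer = (A1′)
«UP-TR ASSEMBLY» FILES E∕F (LH10-p01 (g8)).  THEOREMS ONLY; sorry-free; no definition ∕ instance ∕ notation ∕ named fact; ★-only imports; axioms TRIO.

WHAT.  FILE 1 (★ `…UpTrSlotIntegrable`) proves the two integrability binders of ★ (N4)(c) for a weight `K : T′ → ℂ` on the `G`-Cartan `T′ = Z_G(γ)` with `‖K‖ ≤ B·D_G⁻¹`.  The assembly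
★ (A1′)-E reads them in `H`-torus letters: the weight `K′ : T_H → ℂ` lives on an `H`-Cartan `T_H`, the slot is the embedding `e : T_H ≃ₜ* T′` ((N2b′)), the orbit sum is indexed by `T_H`
(`Σ_{s ∈ T_H, e s ∼ y} K′ s`), the `G`-side binder is `Integrable` on all of `G` (the weight carries the guard `K′ s = 0` unless `e s` is regular), and the torus side is integrated on
`T_H^{G-reg}` against `t_{T_H}`.  This file is that re-lettering:
* §1 `orbitSum_eq_zero_of_notMem_cartanSet` — a `T′`-orbit sum of a weight vanishing at non-regular points vanishes off `G_{T′}`; `integrable_mul_orbitSum_of_le` — hence FILE 1 (ii) gives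
  `Integrable` on `G`; `orbitSum_embedding_eq` — `Σ_{s ∈ T_H, e s ∼ y} K′ s = Σ_{t ∈ T′, t ∼ y} K′(e⁻¹ t)` (finsum re-indexing).
* §2 **`integrable_mul_orbitSum_embedding_of_le`** = E's `hIntG` shape and **`integrableOn_weighted_mul_classOrbitalIntegral_embedding_of_le`** = E's `hIntT` shape, for `f ∈ SchwartzBruhat G`,
  `K′` measurable with the regular guard and `‖K′ s‖ ≤ B·D_G(e s)⁻¹` whenever `e s` is regular and its class meets `tsupport f` (FILE 1 at `K := K′ ∘ e⁻¹`; the torus side transported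
  along `e` by ★ (A1′)-D `integrableOn_and_setIntegral_comp_embedding`, the normalised Haar measure of `T′` from ★ `exists_haar_cartan_compactCore_eq_one`).
FILE F discharges, for E's `K′ s = 𝟙[e s regular]·D_G(e s)⁻¹·(τ(s)·D_H(s)·κ(s, e s)·α(s))`: the guard (by `if_neg`), measurability, and the bound (`‖τ‖, ‖κ‖ ≤ 1` ★ UpDom §1; `‖D_H·α‖ ≤ B` on the
compact of ★-to-be (A0-iv) `…UpTrSupportCompact`; LB antecedent).
HONEST LABEL: count-neutral; UP-TR block consequents move only at the rider editions; organs 2 = 2; h413 registry untouched; HC_CM is proved only modulo the printed citations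
until rung 0 closes.

## References
* [Rogawski1990] J. D. Rogawski, *Automorphic Representations of Unitary Groups in Three Variables*, Ann. of Math. Stud. 123 (1990), §12.5 pp. 182–183 (L. 12.5.1; «the measures on
  `T` and `T_H` correspond under `ψ`»), §4.9 p. 54.
* [HarishChandra1970] Harish-Chandra (notes by G. van Dijk), *Harmonic analysis on reductive p-adic groups*, LNM 162 (1970), Part VII §1 Lemma 42 and Thm. 15.
* [LanglandsShelstad1987] R. P. Langlands, D. Shelstad, *On the definition of transfer factors*, Math. Ann. 278 (1987), §1.3 (admissible embeddings of tori).
-/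

set_option autoImplicit false
-- the mandated namespace has the single-problem summit's repeated segment (`HodgeConjecture.HodgeConjecture`)
set_option linter.dupNamespace false

noncomputable section

open MeasureTheory Measure Set Filter Topology Function NumberField IsDedekindDomain Matrix
open Literature.MeasureTheory.Group
open Literature.NumberTheory.Automorphic Literature.NumberTheory.Automorphic.UnitaryGroup Literature.NumberTheory.Rogawski1990
open Literature.NumberTheory.GaloisRepresentations
open Summit.HodgeConjecture.HodgeConjecture.Cruxes.H413
open Summit.HodgeConjecture.HodgeConjecture.Cruxes.H413.F0P3cStCharTSWeylHypMeasure
open Summit.HodgeConjecture.HodgeConjecture.Cruxes.H413.F0P3cStCharTSWeylCartanRadial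
open Summit.HodgeConjecture.HodgeConjecture.Cruxes.H413.F0P3cStCharTSWeylCartanOrbInt
open Summit.HodgeConjecture.HodgeConjecture.Cruxes.H413.F0P3cStCharTSUpTrSlotIntegrable
open Summit.HodgeConjecture.HodgeConjecture.Cruxes.H413.F0P3cStCharTSUpTrExchange
open scoped ENNReal NNReal MatrixGroups Pointwise

namespace Summit.HodgeConjecture.HodgeConjecture.Cruxes.H413.F0P3cStCharTSUpTrSlotIntegrableH

variable (L : Type) [Field L] [NumberField L] [IsCMField L] (v : HeightOneSpectrum (𝓞 ↥(maximalRealSubfield L)))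

/-! ## §1 Guarded weights: the orbit sum vanishes off `G_T`, so `IntegrableOn G_T` upgrades to `Integrable`; re-indexing along an embedding -/

/-- A `T′`-orbit sum of a weight that VANISHES AT NON-REGULAR POINTS vanishes off the `T′`-regular set `G_{T′}` (a regular `t ∈ T′` conjugate to `y` puts `y` in `G_{T′}`).
[cite: Rogawski1990, §12.5 p. 182] -/
theorem orbitSum_eq_zero_of_notMem_cartanSet {T' : Subgroup (Gqs L v)} (K : ↥T' → ℂ)
    (hK0 : ∀ t : ↥T', ¬ IsRegularElt (((t : Gqs L v)).val : GL (Fin 3) (UnitaryGroup.LocalRing L v)) → K t = 0)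
    (y : Gqs L v) (hy : y ∉ {x | ∃ g t : Gqs L v, t ∈ T' ∧ IsRegularElt (t.val : GL (Fin 3) (UnitaryGroup.LocalRing L v)) ∧ g * t * g⁻¹ = x}) :
    (∑ᶠ t : ↥T', {t' : ↥T' | IsConj ((t' : Gqs L v)) y}.indicator K t) = 0 := by
  refine finsum_eq_zero_of_forall_eq_zero fun t => ?_
  by_cases ht : t ∈ {t' : ↥T' | IsConj ((t' : Gqs L v)) y}
  · rw [indicator_of_mem ht]
    refine hK0 t fun hreg => hy ?_
    obtain ⟨c, hc⟩ := isConj_iff.1 ht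
    exact ⟨c, (t : Gqs L v), t.2, hreg, hc⟩
  · exact indicator_of_notMem ht _

set_option maxHeartbeats 1600000 in
set_option synthInstance.maxHeartbeats 400000 in
-- instance-term unification on the CM local carrier (as ★ (N4))
/-- **FILE 1 (ii) upgraded to `Integrable` on `G`** for a guarded weight: `T′ = Z(γ₀)`, `f ∈ SchwartzBruhat G`, `K` measurable, `K t = 0` at non-regular `t`, and `‖K t‖ ≤ B·D_G(t)⁻¹` at regular `t`
whose class meets `tsupport f` ⇒ `y ↦ f(y)·Σ_{t ∈ T′, t ∼ y} K t` is `ν`-integrable (it vanishes off `G_{T′}`, §1, and is integrable on `G_{T′}`, ★ FILE 1 (ii)).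
[cite: Rogawski1990, §12.5 pp. 182–183] [cite: HarishChandra1970, Part VII §1 Thm. 15] -/
theorem integrable_mul_orbitSum_of_le
    (hns : ∀ w : PlacesOver L v, IsCMField.complexConj L • w.1 = w.1)
    [MeasurableSpace (Gqs L v)] [BorelSpace (Gqs L v)] [LocallyCompactSpace (Gqs L v)] [SecondCountableTopology (Gqs L v)] [T2Space (Gqs L v)]
    (ν : Measure (Gqs L v)) [ν.IsHaarMeasure]
    {T' : Subgroup (Gqs L v)} {γ₀ : Gqs L v} (hγ₀ : IsRegularElt (γ₀.val : GL (Fin 3) (UnitaryGroup.LocalRing L v)))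
    (hT' : T' = Subgroup.centralizer ({γ₀} : Set (Gqs L v)))
    (f : Gqs L v → ℂ) (hf : f ∈ SchwartzBruhat (Gqs L v))
    (K : ↥T' → ℂ) (hK : Measurable K)
    (hK0 : ∀ t : ↥T', ¬ IsRegularElt (((t : Gqs L v)).val : GL (Fin 3) (UnitaryGroup.LocalRing L v)) → K t = 0) (B : ℝ)
    (hKB : ∀ t : ↥T', IsRegularElt (((t : Gqs L v)).val : GL (Fin 3) (UnitaryGroup.LocalRing L v)) → (∃ x : Gqs L v, x * (t : Gqs L v) * x⁻¹ ∈ tsupport f) →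
        ‖K t‖ ≤ B * ((((NNReal.sqrt (NNReal.sqrt ((∏ w : PlacesOver L v, IsNonarchimedeanLocalField.normAbs (w.1.adicCompletion L) (((((t : Gqs L v)).val : GL (Fin 3) (UnitaryGroup.LocalRing L v)).val.charpoly.discr) w)) * ((∏ w : PlacesOver L v, IsNonarchimedeanLocalField.normAbs (w.1.adicCompletion L) (((((t : Gqs L v)).val : GL (Fin 3) (UnitaryGroup.LocalRing L v)).val.det) w)) ^ 2)⁻¹))) : ℝ≥0) : ℝ))⁻¹) :
    Integrable (fun y => f y * ∑ᶠ t : ↥T', {t' : ↥T' | IsConj ((t' : Gqs L v)) y}.indicator K t) ν := by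
  classical
  obtain ⟨Φ, hΦ⟩ := exists_conjFamily T' (mul_comm_cartan hγ₀ hT')
  letI : MeasurableSpace (Gqs L v ⧸ T') := borel _
  haveI : BorelSpace (Gqs L v ⧸ T') := ⟨rfl⟩
  have hGTm : MeasurableSet {x | ∃ g t : Gqs L v, t ∈ T' ∧ IsRegularElt (t.val : GL (Fin 3) (UnitaryGroup.LocalRing L v)) ∧ g * t * g⁻¹ = x} := measurableSet_cartanSet hγ₀ hT' Φ hΦ hns
  have hii := integrableOn_mul_orbitSum_cartanSet_of_le L v hns ν hγ₀ hT' f hf K hK B hKB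
  rw [← integrable_indicator_iff hGTm] at hii
  refine hii.congr (Eventually.of_forall fun y => ?_)
  change Set.indicator _ _ y = f y * _
  by_cases hy : y ∈ {x | ∃ g t : Gqs L v, t ∈ T' ∧ IsRegularElt (t.val : GL (Fin 3) (UnitaryGroup.LocalRing L v)) ∧ g * t * g⁻¹ = x}
  · exact indicator_of_mem hy _
  · rw [indicator_of_notMem hy, orbitSum_eq_zero_of_notMem_cartanSet L v K hK0 y hy, mul_zero]

/-- **Re-indexing the orbit sum along an embedding `e : T_H ≃ₜ* T′`**: `Σ_{s ∈ T_H, e s ∼ y} K′ s = Σ_{t ∈ T′, t ∼ y} K′(e⁻¹ t)` («the measures∕points on `T` and `T_H` correspond under `ψ`»).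
[cite: Rogawski1990, §12.5 p. 183] [cite: LanglandsShelstad1987, §1.3] -/
theorem orbitSum_embedding_eq {TH : Subgroup ((UnitaryGroup.cmDatum L 2 (Matrix.of fun i j : Fin 2 => if i.val + j.val + 1 = 2 then (1 : L) else 0)).Local v × (UnitaryGroup.cmDatum L 1 (Matrix.of fun i j : Fin 1 => if i.val + j.val + 1 = 1 then (1 : L) else 0)).Local v)} {T' : Subgroup (Gqs L v)} (e : ↥TH ≃ₜ* ↥T') (K' : ↥TH → ℂ) (y : Gqs L v) :
    (∑ᶠ s : ↥TH, {s' : ↥TH | IsConj (((e s' : ↥T') : Gqs L v)) y}.indicator K' s) =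
      ∑ᶠ t : ↥T', {t' : ↥T' | IsConj ((t' : Gqs L v)) y}.indicator (fun t => K' (e.symm t)) t := by
  rw [← finsum_comp_equiv e.toEquiv (f := fun t : ↥T' => {t' : ↥T' | IsConj ((t' : Gqs L v)) y}.indicator (fun t => K' (e.symm t)) t)]
  refine finsum_congr fun s => ?_
  have h1 : (e.toEquiv s : ↥T') = e s := rfl
  simp only [h1]
  by_cases hs : IsConj (((e s : ↥T') : Gqs L v)) y
  · rw [indicator_of_mem (show s ∈ {s' : ↥TH | IsConj (((e s' : ↥T') : Gqs L v)) y} from hs),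
      indicator_of_mem (show e s ∈ {t' : ↥T' | IsConj ((t' : Gqs L v)) y} from hs), ContinuousMulEquiv.symm_apply_apply]
  · rw [indicator_of_notMem (show s ∉ {s' : ↥TH | IsConj (((e s' : ↥T') : Gqs L v)) y} from hs),
      indicator_of_notMem (show e s ∉ {t' : ↥T' | IsConj ((t' : Gqs L v)) y} from hs)]

/-! ## §2 The assembly's binders `hIntG` ∕ `hIntT` in `H`-torus letters -/

set_option maxHeartbeats 1600000 in
set_option synthInstance.maxHeartbeats 400000 in
-- instance-term unification on the CM local carriers (as ★ (A1′)-D∕E)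
/-- **(A0 v2)(ii-H) = THE SHAPE OF E's `hIntG`.**  `T_H ≤ H_v` any subgroup with an isomorphism of topological groups `e : T_H ≃ₜ* T′` onto a Cartan `T′ = Z_G(γ)` (`γ` regular, `v` non-split);
`ν` Haar on `G`; `f ∈ SchwartzBruhat G`; `K′ : T_H → ℂ` measurable with the regular guard (`K′ s = 0` unless `e s` is regular) and `‖K′ s‖ ≤ B·D_G(e s)⁻¹` whenever `e s` is regular and its class
meets `tsupport f`.  THEN **`y ↦ f(y) · Σ_{s ∈ T_H, e s ∼ y} K′ s` is `ν`-integrable on `G`** (§1 re-indexing + FILE 1 (ii) at `K := K′ ∘ e⁻¹`).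
[cite: Rogawski1990, §12.5 pp. 182–183] [cite: HarishChandra1970, Part VII §1 Lemma 42 and Thm. 15] -/
theorem integrable_mul_orbitSum_embedding_of_le
    (hns : ∀ w : PlacesOver L v, IsCMField.complexConj L • w.1 = w.1)
    [MeasurableSpace (Gqs L v)] [BorelSpace (Gqs L v)] [LocallyCompactSpace (Gqs L v)] [SecondCountableTopology (Gqs L v)] [T2Space (Gqs L v)]
    [MeasurableSpace ((UnitaryGroup.cmDatum L 2 (Matrix.of fun i j : Fin 2 => if i.val + j.val + 1 = 2 then (1 : L) else 0)).Local v × (UnitaryGroup.cmDatum L 1 (Matrix.of fun i j : Fin 1 => if i.val + j.val + 1 = 1 then (1 : L) else 0)).Local v)] [BorelSpace ((UnitaryGroup.cmDatum L 2 (Matrix.of fun i j : Fin 2 => if i.val + j.val + 1 = 2 then (1 : L) else 0)).Local v × (UnitaryGroup.cmDatum L 1 (Matrix.of fun i j : Fin 1 => if i.val + j.val + 1 = 1 then (1 : L) else 0)).Local v)]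
    (ν : Measure (Gqs L v)) [ν.IsHaarMeasure]
    {TH : Subgroup ((UnitaryGroup.cmDatum L 2 (Matrix.of fun i j : Fin 2 => if i.val + j.val + 1 = 2 then (1 : L) else 0)).Local v × (UnitaryGroup.cmDatum L 1 (Matrix.of fun i j : Fin 1 => if i.val + j.val + 1 = 1 then (1 : L) else 0)).Local v)}
    {T' : Subgroup (Gqs L v)} {γ : Gqs L v} (hγ : IsRegularElt (γ.val : GL (Fin 3) (UnitaryGroup.LocalRing L v)))
    (hT' : T' = Subgroup.centralizer ({γ} : Set (Gqs L v))) (e : ↥TH ≃ₜ* ↥T')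
    (f : Gqs L v → ℂ) (hf : f ∈ SchwartzBruhat (Gqs L v))
    (K' : ↥TH → ℂ) (hK' : Measurable K')
    (hK'0 : ∀ s : ↥TH, ¬ IsRegularElt ((((e s : ↥T') : Gqs L v)).val : GL (Fin 3) (UnitaryGroup.LocalRing L v)) → K' s = 0) (B : ℝ)
    (hK'B : ∀ s : ↥TH, IsRegularElt ((((e s : ↥T') : Gqs L v)).val : GL (Fin 3) (UnitaryGroup.LocalRing L v)) → (∃ x : Gqs L v, x * ((e s : ↥T') : Gqs L v) * x⁻¹ ∈ tsupport f) →
        ‖K' s‖ ≤ B * ((((NNReal.sqrt (NNReal.sqrt ((∏ w : PlacesOver L v, IsNonarchimedeanLocalField.normAbs (w.1.adicCompletion L) ((((((e s : ↥T') : Gqs L v)).val : GL (Fin 3) (UnitaryGroup.LocalRing L v)).val.charpoly.discr) w)) * ((∏ w : PlacesOver L v, IsNonarchimedeanLocalField.normAbs (w.1.adicCompletion L) ((((((e s : ↥T') : Gqs L v)).val : GL (Fin 3) (UnitaryGroup.LocalRing L v)).val.det) w)) ^ 2)⁻¹))) : ℝ≥0) : ℝ))⁻¹) :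
    Integrable (fun y : Gqs L v => f y * ∑ᶠ s : ↥TH, {s' : ↥TH | IsConj (((e s' : ↥T') : Gqs L v)) y}.indicator K' s) ν := by
  have hKm : Measurable (fun t : ↥T' => K' (e.symm t)) := hK'.comp e.symm.continuous.measurable
  have hK0 : ∀ t : ↥T', ¬ IsRegularElt (((t : Gqs L v)).val : GL (Fin 3) (UnitaryGroup.LocalRing L v)) → K' (e.symm t) = 0 := fun t ht =>
    hK'0 (e.symm t) (by rwa [ContinuousMulEquiv.apply_symm_apply])
  have hKB : ∀ t : ↥T', IsRegularElt (((t : Gqs L v)).val : GL (Fin 3) (UnitaryGroup.LocalRing L v)) → (∃ x : Gqs L v, x * (t : Gqs L v) * x⁻¹ ∈ tsupport f) →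
      ‖K' (e.symm t)‖ ≤ B * ((((NNReal.sqrt (NNReal.sqrt ((∏ w : PlacesOver L v, IsNonarchimedeanLocalField.normAbs (w.1.adicCompletion L) (((((t : Gqs L v)).val : GL (Fin 3) (UnitaryGroup.LocalRing L v)).val.charpoly.discr) w)) * ((∏ w : PlacesOver L v, IsNonarchimedeanLocalField.normAbs (w.1.adicCompletion L) (((((t : Gqs L v)).val : GL (Fin 3) (UnitaryGroup.LocalRing L v)).val.det) w)) ^ 2)⁻¹))) : ℝ≥0) : ℝ))⁻¹ := fun t ht hm => by
    have h := hK'B (e.symm t)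
    rw [ContinuousMulEquiv.apply_symm_apply] at h
    exact h ht hm
  have h := integrable_mul_orbitSum_of_le L v hns ν hγ hT' f hf (fun t => K' (e.symm t)) hKm hK0 B hKB
  refine h.congr (Eventually.of_forall fun y => ?_)
  change f y * _ = f y * _
  rw [orbitSum_embedding_eq L v e K' y]

set_option maxHeartbeats 1600000 in
set_option synthInstance.maxHeartbeats 400000 in
-- instance-term unification on the CM local carriers (as ★ (A1′)-D∕E)
/-- **(A0 v2)(iii-H) = THE SHAPE OF E's `hIntT`.**  Same data plus: `mQv` canonical, `tH` a Haar measure on `T_H` with mass one on `compactCore T_H`, and `e` pointwise a norm pair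
(`ι_v(s) ↔ e s`, so `s` is `G`-regular iff `e s` is regular, ★ (A1′)-D §1).  THEN **`s ↦ √radicand(e s) • (K′ s · classOrbitalIntegral mQv f ⟦e s⟧)` is `tH`-integrable on `T_H^{G-reg}`** — FILE 1 (iii)
on `T′` for THE normalised Haar measure of `T′` (★ `exists_haar_cartan_compactCore_eq_one`) at `K := K′ ∘ e⁻¹`, transported along `e` by ★ (A1′)-D `integrableOn_and_setIntegral_comp_embedding`.
[cite: Rogawski1990, §12.5 pp. 182–183; §4.3 (4.3.1) p. 43] [cite: HarishChandra1970, Part VII §1 Lemma 42 and Thm. 15] [cite: LanglandsShelstad1987, §1.3] -/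
theorem integrableOn_weighted_mul_classOrbitalIntegral_embedding_of_le
    (hns : ∀ w : PlacesOver L v, IsCMField.complexConj L • w.1 = w.1)
    [MeasurableSpace (Gqs L v)] [BorelSpace (Gqs L v)] [LocallyCompactSpace (Gqs L v)] [SecondCountableTopology (Gqs L v)] [T2Space (Gqs L v)]
    [∀ γ' : Gqs L v, MeasurableSpace (Gqs L v ⧸ Subgroup.centralizer ({γ'} : Set (Gqs L v)))]
    [∀ γ' : Gqs L v, BorelSpace (Gqs L v ⧸ Subgroup.centralizer ({γ'} : Set (Gqs L v)))]
    [MeasurableSpace ((UnitaryGroup.cmDatum L 2 (Matrix.of fun i j : Fin 2 => if i.val + j.val + 1 = 2 then (1 : L) else 0)).Local v × (UnitaryGroup.cmDatum L 1 (Matrix.of fun i j : Fin 1 => if i.val + j.val + 1 = 1 then (1 : L) else 0)).Local v)] [BorelSpace ((UnitaryGroup.cmDatum L 2 (Matrix.of fun i j : Fin 2 => if i.val + j.val + 1 = 2 then (1 : L) else 0)).Local v × (UnitaryGroup.cmDatum L 1 (Matrix.of fun i j : Fin 1 => if i.val + j.val + 1 = 1 then (1 : L) else 0)).Local v)]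
    (ν : Measure (Gqs L v)) [ν.IsHaarMeasure] [ν.IsMulRightInvariant]
    {mQv : OrbitalMeasureFamily (Gqs L v)} (hcanQ : mQv.IsCanonical (fun γ' => IsRegularElt (γ'.val : GL (Fin 3) (UnitaryGroup.LocalRing L v))) ν)
    {TH : Subgroup ((UnitaryGroup.cmDatum L 2 (Matrix.of fun i j : Fin 2 => if i.val + j.val + 1 = 2 then (1 : L) else 0)).Local v × (UnitaryGroup.cmDatum L 1 (Matrix.of fun i j : Fin 1 => if i.val + j.val + 1 = 1 then (1 : L) else 0)).Local v)} (tH : Measure ↥TH) [tH.IsHaarMeasure] (htH : tH (compactCore ↥TH) = 1)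
    {T' : Subgroup (Gqs L v)} {γ : Gqs L v} (hγ : IsRegularElt (γ.val : GL (Fin 3) (UnitaryGroup.LocalRing L v)))
    (hT' : T' = Subgroup.centralizer ({γ} : Set (Gqs L v))) (e : ↥TH ≃ₜ* ↥T') (he : ∀ s : ↥TH, IsLocalNormPair L (qsForm L) v s.1 (e s).1)
    (f : Gqs L v → ℂ) (hf : f ∈ SchwartzBruhat (Gqs L v))
    (K' : ↥TH → ℂ) (hK' : Measurable K') (B : ℝ)
    (hK'B : ∀ s : ↥TH, IsRegularElt ((((e s : ↥T') : Gqs L v)).val : GL (Fin 3) (UnitaryGroup.LocalRing L v)) → (∃ x : Gqs L v, x * ((e s : ↥T') : Gqs L v) * x⁻¹ ∈ tsupport f) →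
        ‖K' s‖ ≤ B * ((((NNReal.sqrt (NNReal.sqrt ((∏ w : PlacesOver L v, IsNonarchimedeanLocalField.normAbs (w.1.adicCompletion L) ((((((e s : ↥T') : Gqs L v)).val : GL (Fin 3) (UnitaryGroup.LocalRing L v)).val.charpoly.discr) w)) * ((∏ w : PlacesOver L v, IsNonarchimedeanLocalField.normAbs (w.1.adicCompletion L) ((((((e s : ↥T') : Gqs L v)).val : GL (Fin 3) (UnitaryGroup.LocalRing L v)).val.det) w)) ^ 2)⁻¹))) : ℝ≥0) : ℝ))⁻¹) :
    IntegrableOn (fun s : ↥TH => ((NNReal.sqrt ((∏ w : PlacesOver L v, IsNonarchimedeanLocalField.normAbs (w.1.adicCompletion L) ((((((e s : ↥T') : Gqs L v)).val : GL (Fin 3) (UnitaryGroup.LocalRing L v)).val.charpoly.discr) w)) * ((∏ w : PlacesOver L v, IsNonarchimedeanLocalField.normAbs (w.1.adicCompletion L) ((((((e s : ↥T') : Gqs L v)).val : GL (Fin 3) (UnitaryGroup.LocalRing L v)).val.det) w)) ^ 2)⁻¹) : ℝ≥0) : ℝ) • (K' s * classOrbitalIntegral mQv f (ConjClasses.mk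 ((e s : ↥T') : Gqs L v))))
      {s : ↥TH | IsLocalGRegular L v (s : ((UnitaryGroup.cmDatum L 2 (Matrix.of fun i j : Fin 2 => if i.val + j.val + 1 = 2 then (1 : L) else 0)).Local v × (UnitaryGroup.cmDatum L 1 (Matrix.of fun i j : Fin 1 => if i.val + j.val + 1 = 1 then (1 : L) else 0)).Local v))} tH := by
  classical
  obtain ⟨tT, htT1, htT2, htT3⟩ := exists_haar_cartan_compactCore_eq_one hγ hT'
  letI : MeasurableSpace (Gqs L v ⧸ T') := borel _
  haveI : BorelSpace (Gqs L v ⧸ T') := ⟨rfl⟩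
  have hKm : Measurable (fun t : ↥T' => K' (e.symm t)) := hK'.comp e.symm.continuous.measurable
  have hKB : ∀ t : ↥T', IsRegularElt (((t : Gqs L v)).val : GL (Fin 3) (UnitaryGroup.LocalRing L v)) → (∃ x : Gqs L v, x * (t : Gqs L v) * x⁻¹ ∈ tsupport f) →
      ‖K' (e.symm t)‖ ≤ B * ((((NNReal.sqrt (NNReal.sqrt ((∏ w : PlacesOver L v, IsNonarchimedeanLocalField.normAbs (w.1.adicCompletion L) (((((t : Gqs L v)).val : GL (Fin 3) (UnitaryGroup.LocalRing L v)).val.charpoly.discr) w)) * ((∏ w : PlacesOver L v, IsNonarchimedeanLocalField.normAbs (w.1.adicCompletion L) (((((t : Gqs L v)).val : GL (Fin 3) (UnitaryGroup.LocalRing L v)).val.det) w)) ^ 2)⁻¹))) : ℝ≥0) : ℝ))⁻¹ := fun t ht hm => by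
    have h := hK'B (e.symm t)
    rw [ContinuousMulEquiv.apply_symm_apply] at h
    exact h ht hm
  have hiii := integrableOn_weighted_mul_classOrbitalIntegral_of_le L v hns ν hcanQ hγ hT' tT htT3 f hf (fun t => K' (e.symm t)) hKm B hKB
  have htr := ((integrableOn_and_setIntegral_comp_embedding L v hns tH htH hT' tT htT3 e he
    (fun t : ↥T' => ((NNReal.sqrt ((∏ w : PlacesOver L v, IsNonarchimedeanLocalField.normAbs (w.1.adicCompletion L) (((((t : Gqs L v)).val : GL (Fin 3) (UnitaryGroup.LocalRing L v)).val.charpoly.discr) w)) * ((∏ w : PlacesOver L v, IsNonarchimedeanLocalField.normAbs (w.1.adicCompletion L) (((((t : Gqs L v)).val : GL (Fin 3) (UnitaryGroup.LocalRing L v)).val.det) w)) ^ 2)⁻¹) : ℝ≥0) : ℝ) • (K' (e.symm t) * classOrbitalIntegral mQv f (ConjClasses.mk (t : Gqs L v))))).1).1 hiii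
  refine htr.congr_fun_ae (Eventually.of_forall fun s => ?_)
  simp only [ContinuousMulEquiv.symm_apply_apply]

end Summit.HodgeConjecture.HodgeConjecture.Cruxes.H413.F0P3cStCharTSUpTrSlotIntegrableH

end
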